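import Mathlib.NumberTheory.Chebyshev
import Mathlib.NumberTheory.ArithmeticFunction.Misc
import Mathlib.Analysis.SumIntegralComparisons
import Mathlib.Analysis.SpecialFunctions.Integrals.Basic
import Mathlib.Analysis.Complex.ExponentialBounds
import HarnessLib

/-!
# Mertens' first theorem, explicit upper half: `∑_{n ≤ x} Λ(n)/n ≤ log x + 39/50`

Topic `Literature/NumberTheory/LFunctions`. PROOF file (theorems only; no definition, no named
fact). Everything here is proved from Mathlib alone (`Mathlib.NumberTheory.Chebyshev`,
`ArithmeticFunction`, the sum–integral comparison and `∫ log`); in particular it does not use the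
Rosser–Schoenfeld tables of `RosserSchoenfeldMertensFirstProofs.lean`. It sharpens the two bounds of
this shape already in the tree:

* `RosserSchoenfeld.sum_vonMangoldt_div_lt_log_add_one` (`< log x + 1`, through (3.24) of
  Rosser–Schoenfeld 1962 and its kernel-checked chain), and
* `LogFreeDensity.sum_vonMangoldt_div_le` (`≤ log N + log 4 + 2`, Mathlib-only),

to the constant `39/50` (the true values are `∑_{n ≤ x} Λ(n)/n − log x ≤ 0`, `→ −γ`).

The argument is Hardy–Wright's proof of Theorem 424 (§22.6) with every `O(·)` made explicit:

* `sum_log_le` — `∑_{m ≤ N} log m ≤ ∫_1^{N+1} log t dt = (N+1) log(N+1) − N` (Theorem 423 with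
  `h = 1`: left Riemann sum of the increasing function `log`; Mathlib's
  `MonotoneOn.sum_le_integral_Ico` and `integral_log`), whence
  `∑_{m ≤ N} log m − log N ≤ N log N − N + 1 + 1/N` (`sum_log_sub_log_le`);
* Legendre's identity `∑_{n ≤ N} Λ(n) ⌊N/n⌋ = ∑_{m ≤ N} log m` (Theorem 416; here the summed form of
  the Dirichlet-convolution identity `Λ * ζ = log`, Mathlib's `vonMangoldt_mul_zeta` and
  `sum_Ioc_mul_zeta_eq_sum`) and, on the divisors of `N`, `∑_{n ∣ N} Λ(n) = log N`
  (`vonMangoldt_sum`): removing the integer parts costs at most `ψ(N) − log N`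
  (`sum_vonMangoldt_mul_fract_le`), so `N ψ₁(N) ≤ ∑_{m ≤ N} log m + ψ(N) − log N`
  (`mul_sum_vonMangoldt_div_le`), `ψ₁(N) = ∑_{n ≤ N} Λ(n)/n`;
* hence `ψ₁(N) ≤ log N + 39/50` as soon as `ψ(N) ≤ (89/50) N − 3/2`
  (`sum_vonMangoldt_div_le_of_psi_le`);
* **`psi_le_of_two_le` — `ψ(N) ≤ (89/50) N − 3/2` for every `N ≥ 2`**: for `N ≥ 1600` from Mathlib's
  explicit Chebyshev bound `ψ(x) ≤ x log 4 + 2 √x log x` (`Chebyshev.psi_le`) and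
  `log s ≤ log 40 + s/40 − 1`, `s = √N` (`chebyshevBound_le`); for `2 ≤ N ≤ 1786` from
  `ψ(B) = log lcm(1,…,B)` (`Chebyshev.psi_eq_log_lcmUpto`), monotonicity of `ψ`, and twelve
  kernel-checked certificates `lcm(1,…,B) ≤ 2^k` on blocks `[A, B]` with `k log 2 ≤ (89/50) A − 3/2`
  (`psi_le_of_lcmUpto_le`, `psi_le_of_le`);
* **`sum_vonMangoldt_div_le_log_add` — `∑_{n ≤ N} Λ(n)/n ≤ log N + 39/50` for every natural
  `N ≥ 1`**, and the real-variable form **`sum_vonMangoldt_div_floor_le_log_add`** —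
  `∑_{n ≤ x} Λ(n)/n ≤ log x + 39/50` for real `x ≥ 1`.

What is NOT here: the lower half `∑_{n ≤ x} Λ(n)/n ≥ log x − C` (Theorem 424 is two-sided), the
sharp constants of Rosser–Schoenfeld ((3.21)–(3.24)), and anything below the constant
`log 4 − 1 + o(1)` that this method can reach (the certificates stop at `1786`, the analytic range
starts at `1600`).

## References

* G. H. Hardy, E. M. Wright, *An Introduction to the Theory of Numbers*, 6th ed. (2008), §22.6,
  Theorems 416, 423, 424. [HardyWright2008]
* P. L. Chebyshev, *Mémoire sur les nombres premiers*, J. Math. Pures Appl. 17 (1852), 366–390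
  (`ψ(x) = O(x)` with explicit constants). [Chebyshev1852]
-/

noncomputable section

open scoped Chebyshev
open ArithmeticFunction (vonMangoldt)

namespace Literature.NumberTheory.LFunctions.MertensFirstUpper

/-! ### `log N!` against the integral of `log` -/

/-- `Σ_{1 ≤ m ≤ N} log m ≤ (N+1) log(N+1) − N = ∫_1^{N+1} log t dt` (left Riemann sum of the
increasing function `log`; Hardy–Wright's Theorem 423 with `h = 1`).
[cite: HardyWright2008, §22.6 Thm 423] -/
theorem sum_log_le (N : ℕ) :
    ∑ m ∈ Finset.Icc 1 N, Real.log m ≤ ((N : ℝ) + 1) * Real.log ((N : ℝ) + 1) - N := by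
  have hmono : MonotoneOn Real.log (Set.Icc ((1 : ℕ) : ℝ) ((N + 1 : ℕ) : ℝ)) :=
    Real.strictMonoOn_log.monotoneOn.mono fun x hx ↦
      Set.mem_Ioi.2 (lt_of_lt_of_le (by norm_num) hx.1)
  have h := MonotoneOn.sum_le_integral_Ico (by omega : 1 ≤ N + 1) hmono
  rw [integral_log] at h
  have hI : Finset.Ico 1 (N + 1) = Finset.Icc 1 N := by
    ext n
    simp only [Finset.mem_Ico, Finset.mem_Icc]
    omega
  rw [hI] at h
  push_cast at h
  have h1 : Real.log 1 = 0 := Real.log_one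
  nlinarith [h, h1]

/-- `Σ_{1 ≤ m ≤ N} log m − log N ≤ N log N − N + 1 + 1/N` for `N ≥ 1`
(`(N+1) log(N+1) = (N+1)(log N + log(1 + 1/N)) ≤ (N+1) log N + (N+1)/N`). [folklore] -/
theorem sum_log_sub_log_le {N : ℕ} (hN : 1 ≤ N) :
    ∑ m ∈ Finset.Icc 1 N, Real.log m - Real.log N ≤ N * Real.log N - N + 1 + 1 / N := by
  have h := sum_log_le N
  have hN0 : (0 : ℝ) < N := by exact_mod_cast hN
  have hq : Real.log (((N : ℝ) + 1) / N) ≤ ((N : ℝ) + 1) / N - 1 :=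
    Real.log_le_sub_one_of_pos (by positivity)
  rw [Real.log_div (by positivity) hN0.ne'] at hq
  have he : ((N : ℝ) + 1) / N = 1 + 1 / N := by
    field_simp
  rw [he] at hq
  have h2 : ((N : ℝ) + 1) * Real.log ((N : ℝ) + 1) ≤ ((N : ℝ) + 1) * (Real.log N + 1 / N) :=
    mul_le_mul_of_nonneg_left (by linarith) (by positivity)
  have h3 : ((N : ℝ) + 1) * (Real.log N + 1 / N) = N * Real.log N + Real.log N + 1 + 1 / N := by
    field_simp
    ring
  linarith

/-! ### The convolution identity `Λ * ζ = log`, used twice -/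

/-- Chebyshev's identity `Σ_{1 ≤ n ≤ N} Λ(n) ⌊N/n⌋ = Σ_{1 ≤ m ≤ N} log m`, the summed form of the
Dirichlet-convolution identity `Λ * ζ = log` (Legendre's formula for `N!`).
[cite: HardyWright2008, §22.2 Thm 416] -/
theorem sum_vonMangoldt_mul_div (N : ℕ) :
    ∑ n ∈ Finset.Icc 1 N, vonMangoldt n * ((N / n : ℕ) : ℝ) = ∑ m ∈ Finset.Icc 1 N, Real.log m := by
  have hI : Finset.Icc 1 N = Finset.Ioc 0 N := by
    ext n
    simp only [Finset.mem_Ioc, Finset.mem_Icc]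
    omega
  rw [hI, ← ArithmeticFunction.sum_Ioc_mul_zeta_eq_sum, ArithmeticFunction.vonMangoldt_mul_zeta]
  exact Finset.sum_congr rfl fun m _ ↦ ArithmeticFunction.log_apply

/-- `Σ_{n ∣ N} Λ(n) = log N`, the divisors presented as `{n ∈ [1, N] : n ∣ N}` (`N ≠ 0`).
[folklore] -/
theorem sum_filter_dvd_vonMangoldt {N : ℕ} (hN : N ≠ 0) :
    ∑ n ∈ (Finset.Icc 1 N).filter (· ∣ N), vonMangoldt n = Real.log N := by
  have h : (Finset.Icc 1 N).filter (· ∣ N) = N.divisors := by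
    ext n
    simp only [Finset.mem_filter, Finset.mem_Icc, Nat.mem_divisors]
    constructor
    · rintro ⟨-, h⟩
      exact ⟨h, hN⟩
    · rintro ⟨h, -⟩
      exact ⟨⟨Nat.pos_of_dvd_of_pos h (Nat.pos_of_ne_zero hN),
        Nat.le_of_dvd (Nat.pos_of_ne_zero hN) h⟩, h⟩
  rw [h, ArithmeticFunction.vonMangoldt_sum]

/-- The fractional parts against `Λ`: `Σ_{n ≤ N} Λ(n) (N/n − ⌊N/n⌋) ≤ ψ(N) − log N` for `N ≥ 1`:
`N/n − ⌊N/n⌋ = (N mod n)/n ∈ [0, 1)` vanishes when `n ∣ N`, and `Σ_{n ∣ N} Λ(n) = log N`.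
[folklore] -/
theorem sum_vonMangoldt_mul_fract_le {N : ℕ} (hN : 1 ≤ N) :
    ∑ n ∈ Finset.Icc 1 N, vonMangoldt n * ((N : ℝ) / n - ((N / n : ℕ) : ℝ)) ≤
      ψ (N : ℝ) - Real.log N := by
  have hpsi : ψ (N : ℝ) = ∑ n ∈ Finset.Icc 1 N, vonMangoldt n := by
    rw [Chebyshev.psi, Nat.floor_natCast]
    refine Finset.sum_congr ?_ fun _ _ ↦ rfl
    ext n
    simp only [Finset.mem_Ioc, Finset.mem_Icc]
    omega
  have hlog := sum_filter_dvd_vonMangoldt (N := N) (by omega)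
  rw [Finset.sum_filter] at hlog
  rw [hpsi, ← hlog, ← Finset.sum_sub_distrib]
  refine Finset.sum_le_sum fun n hn ↦ ?_
  have hn1 : 1 ≤ n := (Finset.mem_Icc.1 hn).1
  have hΛ : 0 ≤ vonMangoldt n := ArithmeticFunction.vonMangoldt_nonneg
  have hn0 : (0 : ℝ) < n := by exact_mod_cast hn1
  have key : (n : ℝ) * ((N / n : ℕ) : ℝ) + ((N % n : ℕ) : ℝ) = N := by
    exact_mod_cast Nat.div_add_mod N n
  have hdm : (N : ℝ) / n - ((N / n : ℕ) : ℝ) = ((N % n : ℕ) : ℝ) / n := by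
    rw [eq_div_iff hn0.ne', sub_mul, div_mul_cancel₀ _ hn0.ne']
    linarith
  rw [hdm]
  split_ifs with hd
  · rw [Nat.mod_eq_zero_of_dvd hd]
    simp
  · rw [sub_zero]
    have h1 : ((N % n : ℕ) : ℝ) / n ≤ 1 := by
      rw [div_le_one hn0]
      exact_mod_cast (Nat.mod_lt N (by omega)).le
    calc vonMangoldt n * (((N % n : ℕ) : ℝ) / n) ≤ vonMangoldt n * 1 :=
          mul_le_mul_of_nonneg_left h1 hΛ
      _ = vonMangoldt n := mul_one _

/-- `N ψ₁(N) ≤ Σ_{m ≤ N} log m + ψ(N) − log N` for `N ≥ 1` (`N/n = ⌊N/n⌋ + {N/n}`, Chebyshev's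
identity for the integer parts, `sum_vonMangoldt_mul_fract_le` for the fractional parts).
[folklore] -/
theorem mul_sum_vonMangoldt_div_le {N : ℕ} (hN : 1 ≤ N) :
    (N : ℝ) * ∑ n ∈ Finset.Icc 1 N, vonMangoldt n / n ≤
      ∑ m ∈ Finset.Icc 1 N, Real.log m + (ψ (N : ℝ) - Real.log N) := by
  have h := sum_vonMangoldt_mul_fract_le hN
  have hsplit : ∑ n ∈ Finset.Icc 1 N, vonMangoldt n * ((N : ℝ) / n - ((N / n : ℕ) : ℝ)) =
      (N : ℝ) * ∑ n ∈ Finset.Icc 1 N, vonMangoldt n / n -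
        ∑ n ∈ Finset.Icc 1 N, vonMangoldt n * ((N / n : ℕ) : ℝ) := by
    rw [Finset.mul_sum, ← Finset.sum_sub_distrib]
    exact Finset.sum_congr rfl fun n _ ↦ by ring
  rw [← sum_vonMangoldt_mul_div N]
  linarith

/-- If `ψ(N) ≤ (89/50) N − 3/2` (`N ≥ 2`) then `ψ₁(N) ≤ log N + 39/50`. [folklore] -/
theorem sum_vonMangoldt_div_le_of_psi_le {N : ℕ} (hN : 2 ≤ N)
    (hpsi : ψ (N : ℝ) ≤ 89 / 50 * N - 3 / 2) :
    ∑ n ∈ Finset.Icc 1 N, vonMangoldt n / n ≤ Real.log N + 39 / 50 := by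
  have hN2 : (2 : ℝ) ≤ N := by exact_mod_cast hN
  have hN0 : (0 : ℝ) < N := by linarith
  have h1 := mul_sum_vonMangoldt_div_le (N := N) (by omega)
  have h2 := sum_log_sub_log_le (N := N) (by omega)
  have h3 : 1 / (N : ℝ) ≤ 1 / 2 := by
    gcongr
  have h4 : (N : ℝ) * ∑ n ∈ Finset.Icc 1 N, vonMangoldt n / n ≤ N * (Real.log N + 39 / 50) := by
    linarith
  exact le_of_mul_le_mul_left h4 hN0

/-! ### `ψ(N) ≤ (89/50) N − 3/2`: certificates below `1786`, Chebyshev's bound above `1600` -/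

/-- Certificate step: on a block `A ≤ N ≤ B`, `ψ(N) ≤ ψ(B) = log lcm(1,…,B) ≤ k log 2` whenever
`lcm(1,…,B) ≤ 2^k`; so `k log 2 ≤ (89/50) A − 3/2` gives `ψ(N) ≤ (89/50) N − 3/2` on the block.
[folklore] -/
theorem psi_le_of_lcmUpto_le {A B k N : ℕ} (hcert : Nat.lcmUpto B ≤ 2 ^ k)
    (hk : (k : ℝ) * 0.6931471808 ≤ 89 / 50 * A - 3 / 2) (hA : A ≤ N) (hB : N ≤ B) :
    ψ (N : ℝ) ≤ 89 / 50 * N - 3 / 2 := by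
  have h1 : ψ (N : ℝ) ≤ ψ (B : ℝ) := Chebyshev.psi_mono (by exact_mod_cast hB)
  have h2 : ψ (B : ℝ) ≤ k * Real.log 2 := by
    rw [Chebyshev.psi_eq_log_lcmUpto, ← Real.log_pow]
    exact Real.log_le_log (by exact_mod_cast Nat.lcmUpto_pos B) (by exact_mod_cast hcert)
  have h3 : (k : ℝ) * Real.log 2 ≤ k * 0.6931471808 :=
    mul_le_mul_of_nonneg_left Real.log_two_lt_d9.le (Nat.cast_nonneg k)
  have hA' : (A : ℝ) ≤ N := by exact_mod_cast hA
  linarith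

/-- `ψ(N) ≤ (89/50) N − 3/2` for `2 ≤ N ≤ 1786`, by twelve kernel-checked certificates
`lcm(1,…,B) ≤ 2^k` on the blocks `[2,2]`, `[3,4]`, `[5,8]`, `[9,16]`, `[17,28]`, `[29,52]`,
`[53,96]`, `[97,172]`, `[173,310]`, `[311,562]`, `[563,1008]`, `[1009,1786]`. [folklore] -/
theorem psi_le_of_le {N : ℕ} (hN2 : 2 ≤ N) (hN : N ≤ 1786) :
    ψ (N : ℝ) ≤ 89 / 50 * N - 3 / 2 := by
  rcases le_or_gt N 2 with ha | ha
  · exact psi_le_of_lcmUpto_le (A := 2) (B := 2) (k := 2) (by decide +kernel) (by norm_num)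
      hN2 ha
  rcases le_or_gt N 4 with hb | hb
  · exact psi_le_of_lcmUpto_le (A := 3) (B := 4) (k := 4) (by decide +kernel) (by norm_num)
      (by omega) hb
  rcases le_or_gt N 8 with hc | hc
  · exact psi_le_of_lcmUpto_le (A := 5) (B := 8) (k := 10) (by decide +kernel) (by norm_num)
      (by omega) hc
  rcases le_or_gt N 16 with hd | hd
  · exact psi_le_of_lcmUpto_le (A := 9) (B := 16) (k := 20) (by decide +kernel) (by norm_num)
      (by omega) hd
  rcases le_or_gt N 28 with he | he
  · exact psi_le_of_lcmUpto_le (A := 17) (B := 28) (k := 37) (by decide +kernel) (by norm_num)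
      (by omega) he
  rcases le_or_gt N 52 with hf | hf
  · exact psi_le_of_lcmUpto_le (A := 29) (B := 52) (k := 72) (by decide +kernel) (by norm_num)
      (by omega) hf
  rcases le_or_gt N 96 with hg | hg
  · exact psi_le_of_lcmUpto_le (A := 53) (B := 96) (k := 130) (by decide +kernel) (by norm_num)
      (by omega) hg
  rcases le_or_gt N 172 with hh | hh
  · exact psi_le_of_lcmUpto_le (A := 97) (B := 172) (k := 245) (by decide +kernel) (by norm_num)
      (by omega) hh
  rcases le_or_gt N 310 with hi | hi
  · exact psi_le_of_lcmUpto_le (A := 173) (B := 310) (k := 440) (by decide +kernel) (by norm_num)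
      (by omega) hi
  rcases le_or_gt N 562 with hj | hj
  · exact psi_le_of_lcmUpto_le (A := 311) (B := 562) (k := 793) (by decide +kernel) (by norm_num)
      (by omega) hj
  rcases le_or_gt N 1008 with hk | hk
  · exact psi_le_of_lcmUpto_le (A := 563) (B := 1008) (k := 1438) (by decide +kernel)
      (by norm_num) (by omega) hk
  exact psi_le_of_lcmUpto_le (A := 1009) (B := 1786) (k := 2578) (by decide +kernel) (by norm_num)
    (by omega) hN

/-- `log 40 < 3.6968` (`40³ ≤ 2¹⁶` and `log 2 < 0.6931471808`). [folklore] -/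
theorem log_forty_lt : Real.log 40 < 3.6968 := by
  have h : Real.log ((40 : ℝ) ^ 3) ≤ Real.log ((2 : ℝ) ^ 16) :=
    Real.log_le_log (by norm_num) (by norm_num)
  rw [Real.log_pow, Real.log_pow] at h
  have h2 := Real.log_two_lt_d9
  push_cast at h
  linarith

/-- The analytic range: for `N ≥ 1600`, `N log 4 + 2 √N log N ≤ (89/50) N − 3/2`. With
`s = √N ≥ 40`: `log s ≤ log 40 + s/40 − 1`, so `2 √N log N = 4 s log s ≤ 4 s (2.6968 + s/40)`, and
`log 4 < 1.3863`. [folklore] -/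
theorem chebyshevBound_le {N : ℕ} (hN : 1600 ≤ N) :
    Real.log 4 * N + 2 * Real.sqrt N * Real.log N ≤ 89 / 50 * N - 3 / 2 := by
  set s := Real.sqrt (N : ℝ) with hs
  have hN' : (1600 : ℝ) ≤ N := by exact_mod_cast hN
  have hNs : (N : ℝ) = s ^ 2 := (Real.sq_sqrt (Nat.cast_nonneg N)).symm
  have hs40 : (40 : ℝ) ≤ s := by
    rw [hs, Real.le_sqrt (by norm_num) (Nat.cast_nonneg N)]
    linarith
  have hs0 : (0 : ℝ) < s := by linarith
  have hlogN : Real.log N = 2 * Real.log s := by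
    rw [hNs, Real.log_pow]
    push_cast
    ring
  have hlogs : Real.log s ≤ Real.log 40 + (s / 40 - 1) := by
    have h := Real.log_le_sub_one_of_pos (show (0 : ℝ) < s / 40 by positivity)
    rw [Real.log_div hs0.ne' (by norm_num)] at h
    linarith
  have hl4 : Real.log 4 = 2 * Real.log 2 := by
    rw [show (4 : ℝ) = 2 ^ 2 by norm_num, Real.log_pow]
    push_cast
    ring
  have hl2 := Real.log_two_lt_d9
  have hl40 := log_forty_lt
  rw [hlogN, hNs, hl4]
  have k1 : s * Real.log s ≤ s * (Real.log 40 + (s / 40 - 1)) :=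
    mul_le_mul_of_nonneg_left hlogs hs0.le
  have k2 : s * Real.log 40 ≤ s * 3.6968 := mul_le_mul_of_nonneg_left hl40.le hs0.le
  have k3 : s ^ 2 * Real.log 2 ≤ s ^ 2 * 0.6931471808 :=
    mul_le_mul_of_nonneg_left hl2.le (by positivity)
  have k4 : 40 * s ≤ s ^ 2 := by
    rw [sq]
    exact mul_le_mul_of_nonneg_right hs40 hs0.le
  linarith

/-- **Chebyshev bound in the required shape**: `ψ(N) ≤ (89/50) N − 3/2` for every `N ≥ 2`
(certificates up to `1786`, Mathlib's `Chebyshev.psi_le` beyond `1600`): Chebyshev's `ψ(x) < A x` in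
the affine shape the Mertens argument consumes. [cite: HardyWright2008, §22.2 Thm 414] -/
theorem psi_le_of_two_le {N : ℕ} (hN : 2 ≤ N) : ψ (N : ℝ) ≤ 89 / 50 * N - 3 / 2 := by
  rcases le_or_gt N 1786 with h | h
  · exact psi_le_of_le hN h
  · have h1 : (1 : ℝ) ≤ N := by exact_mod_cast (show 1 ≤ N by omega)
    exact (Chebyshev.psi_le h1).trans (chebyshevBound_le (by omega))

/-! ### The Mertens-type bound -/

/-- **Mertens' first theorem, explicit upper half** (Hardy–Wright Theorem 424 with the `O(1)` made
explicit): `ψ₁(N) = ∑_{n ≤ N} Λ(n)/n ≤ log N + 39/50` for every natural `N ≥ 1` (the case `N = 1`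
is `0 ≤ 39/50`; `N ≥ 2` by `sum_vonMangoldt_div_le_of_psi_le` and `psi_le_of_two_le`).
[cite: HardyWright2008, §22.6 Thm 424] -/
theorem sum_vonMangoldt_div_le_log_add {N : ℕ} (hN : 1 ≤ N) :
    ∑ n ∈ Finset.Icc 1 N, vonMangoldt n / n ≤ Real.log N + 39 / 50 := by
  rcases eq_or_lt_of_le hN with h | h
  · subst h
    simp only [Finset.Icc_self, Finset.sum_singleton, Nat.cast_one, div_one,
      ArithmeticFunction.vonMangoldt_apply_one, Real.log_one, zero_add]
    norm_num
  · exact sum_vonMangoldt_div_le_of_psi_le h (psi_le_of_two_le h)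

/-- **Mertens' first theorem, explicit upper half, real variable**: for real `x ≥ 1`,
`∑_{n ≤ x} Λ(n)/n ≤ log x + 39/50` (the sum over `0 < n ≤ ⌊x⌋`, as in
`RosserSchoenfeld.sum_vonMangoldt_div_lt_log_add_one`). [cite: HardyWright2008, §22.6 Thm 424] -/
theorem sum_vonMangoldt_div_floor_le_log_add {x : ℝ} (hx : 1 ≤ x) :
    ∑ n ∈ Finset.Ioc 0 ⌊x⌋₊, vonMangoldt n / n ≤ Real.log x + 39 / 50 := by
  have h1 : 1 ≤ ⌊x⌋₊ := Nat.le_floor (by exact_mod_cast hx)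
  have hI : Finset.Ioc 0 ⌊x⌋₊ = Finset.Icc 1 ⌊x⌋₊ := by
    ext n
    simp only [Finset.mem_Ioc, Finset.mem_Icc]
    omega
  rw [hI]
  have h := sum_vonMangoldt_div_le_log_add h1
  have hfl : Real.log (⌊x⌋₊ : ℕ) ≤ Real.log x :=
    Real.log_le_log (by exact_mod_cast h1) (Nat.floor_le (by linarith))
  linarith

end Literature.NumberTheory.LFunctions.MertensFirstUpper

end
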